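import Literature.NumberTheory.ComplexMultiplication.FaltingsTateOfCMEllipticPowers
import Summits.HodgeConjecture.HodgeConjecture.Theorems.HCCMUnconditionalShimuraThm18_6Holds
import HarnessLib

/-!
# T5 §6.5 — [Fal83 §5 Kor. 1] for every PAIR OF POWERS of a CM elliptic structure, UNCONDITIONALLY

Cell hodgecm-mathlib, fan A, binder hLiu418 (item stmt-HodgeConjecture-24832), sub-skeleton
`Cruxes/HLiu418/Lines/faltings_isogeny.lean` (row VI-1 = the floor binder
`hFal : ∀ {K} [Field K] (A B : AbelianVariety K) ℓ [Fact ℓ.Prime], faltings_tate_bijective A B ℓ`;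
FALTINGS-SPEC §6.5 / §9 witness ledger).  The Literature head
`Literature.NumberTheory.ComplexMultiplication.faltings_tate_bijective_pow_pow_of_CM_elliptic_of_thm18_6`
proves, granted the named fact `shimura1998_thm18_6` ([Shimura 1998, Thm. 18.6]), that for every structure
`(A₀, ι₀ : 𝓞_K → End A₀)` of CM type `(K, Φ)` over a field `k → ℂ` (the predicate quantifies over
`[NumberField k]`) with `[K : ℚ] = 2`, all `a, b` and every prime `ℓ`, the Tate map
`ℤ_ℓ ⊗ Hom_k(A₀ᵃ, A₀ᵇ) → Hom_{Γ_k}(T_ℓ A₀ᵃ, T_ℓ A₀ᵇ)` is bijective; that fact is a THEOREM of the tree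
Summits-side (`Theorems.shimura1998_thm18_6_holds`, row II-1), so here the VI-1 TEXT ITSELF is decided
with NO hypothesis on the instance family {pairs of powers of one CM elliptic structure} — beyond the
★ `(A₀, A₀)` case of `HLiu418FaltingsTateOfCMElliptic` (which it re-derives by another road:
Steinitz / Jordan–Zassenhaus pigeonhole in `(ℤ_ℓ ⊗ 𝓞_K)ʳ` + Tate's argument with Zarhin's corner,
instead of the commutant of a non-scalar Frobenius).  Witness rung; no floor change.

HC_CM is proved only modulo the printed citations of the floor until rung 0 closes; this file moves
no floor binder.
-/

-- mandated namespace `Summit.HodgeConjecture.HodgeConjecture.Theorems` trips `linter.dupNamespace` (single-problem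
-- summit); off as in `HCCMUnconditionalShimuraThm18_6Holds.lean`.
set_option linter.dupNamespace false

open CategoryTheory CategoryTheory.Limits NumberField
open scoped NumberField

namespace Summit.HodgeConjecture.HodgeConjecture.Theorems

open Literature.AlgebraicGeometry.Motives
open Literature.NumberTheory.ComplexMultiplication

/-- **[Faltings 1983, §5 Kor. 1] for every pair of powers of a CM elliptic structure, unconditionally**:
for `(A₀, ι₀)` of CM type `(K, Φ)` over a field `k → ℂ`, `[K : ℚ] = 2`, all `a b : ℕ` and every prime
`ℓ`, `faltings_tate_bijective (⨁_{Fin a} A₀) (⨁_{Fin b} A₀) ℓ` (over number fields `k`, as the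
predicate quantifies) — the Literature head `faltings_tate_bijective_pow_pow_of_CM_elliptic_of_thm18_6`
fed with the tree's theorem `shimura1998_thm18_6_holds` ([Shimura 1998, Thm. 18.6], row II-1).
[cite: Faltings1983Endlichkeit, §5 Korollar 1] [cite: Shimura1998, §18.6 Theorem 18.6; §7.4 Propositions 15 and 17] -/
theorem faltings_tate_bijective_pow_pow_of_CM_elliptic :
    ∀ {k : Type} [Field k] [Algebra k ℂ] {K : Type} [Field K] [NumberField K]
      [IsCMField K] (Φ : CMType K) (A₀ : AbelianVariety k) (ι₀ : 𝓞 K →+* End A₀),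
      IsCMTypeRealisationOver Φ A₀ ι₀ → Module.finrank ℚ K = 2 →
      ∀ (a b ℓ : ℕ) [Fact ℓ.Prime],
        faltings_tate_bijective (⨁ fun _ : Fin a => A₀) (⨁ fun _ : Fin b => A₀) ℓ :=
  Literature.NumberTheory.ComplexMultiplication.faltings_tate_bijective_pow_pow_of_CM_elliptic_of_thm18_6
    shimura1998_thm18_6_holds

/-- **[Faltings 1983, §5 Kor. 1] on the whole isogeny class of powers of a CM elliptic structure,
unconditionally**: for `(A₀, ι₀)` of CM type `(K, Φ)` over a field `k → ℂ`, `[K : ℚ] = 2`, every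
`A` `k`-isogenous to `⨁_{Fin a} A₀`, every `B` `k`-isogenous to `⨁_{Fin b} A₀` and every prime `ℓ`,
`faltings_tate_bijective A B ℓ` (over number fields `k`, as the predicate quantifies) — the Literature
head `faltings_tate_bijective_of_isIsogenous_pow_of_CM_elliptic_of_thm18_6` fed with the tree's theorem
`shimura1998_thm18_6_holds`. [cite: Faltings1983Endlichkeit, §5 Korollar 1]
[cite: Shimura1998, §18.6 Theorem 18.6; §7.4 Propositions 15 and 17] -/
theorem faltings_tate_bijective_of_isIsogenous_pow_of_CM_elliptic :
    ∀ {k : Type} [Field k] [Algebra k ℂ] {K : Type} [Field K] [NumberField K]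
      [IsCMField K] (Φ : CMType K) (A₀ : AbelianVariety k) (ι₀ : 𝓞 K →+* End A₀),
      IsCMTypeRealisationOver Φ A₀ ι₀ → Module.finrank ℚ K = 2 →
      ∀ (a b : ℕ) (A B : AbelianVariety k), AbelianVariety.IsIsogenous (⨁ fun _ : Fin a => A₀) A →
        AbelianVariety.IsIsogenous (⨁ fun _ : Fin b => A₀) B → ∀ (ℓ : ℕ) [Fact ℓ.Prime],
        faltings_tate_bijective A B ℓ :=
  Literature.NumberTheory.ComplexMultiplication.faltings_tate_bijective_of_isIsogenous_pow_of_CM_elliptic_of_thm18_6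
    shimura1998_thm18_6_holds

end Summit.HodgeConjecture.HodgeConjecture.Theorems
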